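import Summits.QuantumFields.YangMills.Theorems.UnitScaleTiltProp7OneFormAgmonLetters
import Summits.QuantumFields.YangMills.Theorems.UnitScaleTiltProp7OneFormDecayLetters
import HarnessLib

/-!
# Route `UnitScaleTilt`, crux K1 «MinimiserStabilityRegPr» (stmt-QuantumFields-19200), EX face S46 — (L3′b), ONE-FORM STOREY, FILE O4e:
# **A DISPLAYED KERNEL ROW TIMES THE `L²` BLOCK DECAY OF THE SOLUTION GIVES A DECAYED POINTWISE BOUND** — the non-local pieces (D) `D(1 − R_S)D*u` and (Q) `aQ_k†Q_k u` of the
# O1∕O2 remainder as the `s_D·e^{−r·d(p)}` part of the `hqdom` letter of O4 ✓`pointwiseDecay_oneForm_of_letters`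

Cell `ym3-torus` (HUMAN RULING D-0037; rung R3 = SU(2) YM₃ on T³ — NOT d = 4, NOT infinite volume, NOT a mass gap, NOT Clay).  Chair seat ★`ym-ust-19200-p1` g26, own pen O4e.
THEOREMS ONLY (0 `def`, 0 `sorry`, default heartbeats); `--supports stmt-QuantumFields-19200 --as helper`; count-neutral.

THE ARGUMENT.  `B` linear with the DISPLAYED pointwise kernel row `‖(B δ_b Z)(b_d)‖ ≤ C_k·e^{−μ′·tdist(B(b), B(b_d))}·‖Z‖` (A2a's `hk` text = the member text of the EX row `h349`,
✓-fed for `B = D(1−R_S)D*` by px10's ✓`kernelRow349_allMembers_exists`; the same shape for `aQ_k†Q_k` is tube-local).  Expand `X = Σ_b δ_b X(b)`, group the bonds by the block of their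
source, Cauchy–Schwarz inside each block (`d·ℓ^d` bonds, ✓`card_iterBlock`; `|X(b)| ≤ ‖frobEquiv⁻¹X(b)‖`, ✓`norm_sq_toL2`), feed the `L²` BLOCK DECAY `‖1_y X‖ ≤ D₀·e^{−r·tdist(y, v)}`
(A4 ✓`blockDecay_oneForm_of_letters`), and close with the two-rate bracket on the coarse torus (✓`tdist_coarse_triangle`, ✓`sum_exp_neg_mul_tdist_coarse_le` at rate `μ′ − r`).
WHAT IS PROVED (ns `Summit.QuantumFields.YangMills.Theorems.Prop7OneFormRemainderDecay`).
* `card_filter_src_block_eq` — a block carries `d·(L^d)^{K−n}` bonds; ★ `sum_norm_block_le` — `Σ_{b ∈ y} |X(b)| ≤ √(d·(L^d)^{K−n}∕c₀)·‖toL2(1_y X)‖`.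
* ★★★ `norm_symm_apply_le_of_kernelRow_blockDecay` — `|(toL2⁻¹(B(toL2 X)))(b_d)| ≤ C_k·√(d(L^d)^{K−n}∕c₀)·D₀·(2(1+1∕(μ′−r)))³·e^{−r·tdist(B(b_d), v)}` (`0 ≤ r < μ′`).
  At the pin `C_k = C·ℓ⁻³`, `c₀ = ℓ⁻³`: `C_k·√(dℓ^d∕c₀) = C√d` — K-FREE.
HONEST SCOPE.  Bookkeeping over displayed letters; nothing of the ten EX rows, `hT`, (3.42), EX or the crux is proved here.

References: T. Bałaban, CMP **99** (1985) 389–434 [Balaban1985BackgroundPropagators] (Thm 3.1 (3.42) p.397, (3.46) p.398, (3.49) p.399); CMP **95** (1984) 17–40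
[Balaban1984PropagatorsI] (Prop. 1.1 p.33).
-/

set_option autoImplicit false

noncomputable section

open scoped BigOperators Matrix.Norms.L2Operator InnerProductSpace ComplexConjugate

namespace Summit.QuantumFields.YangMills.Theorems.Prop7OneFormRemainderDecay

open Literature.MathematicalPhysics.QuantumFieldTheory.Balaban1983to89
open Literature.MathematicalPhysics.QuantumFieldTheory.Balaban1983to89.T3ContinuumYM3Torus
open B11Eq103H1Complex (BondL2K)
open B5Eq118OneStroke (iterBlockOf iterBlock mem_iterBlock card_iterBlock)
open Summit.QuantumFields.YangMills.Theorems.Prop7SectET3Transport (periodsT3 bondEquiv)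
open Summit.QuantumFields.YangMills.Theorems.Prop7SectET3HilbertLetters (W₂ frobEquiv toL2)
open Summit.QuantumFields.YangMills.Theorems.Prop7SectET3DeltaEtaExplicit (sum_pbond_eq)
open Summit.QuantumFields.YangMills.Theorems.Prop7RieszTauFrobNorm (norm_sq_frobEquiv_symm norm_le_norm_frobEquiv_symm)
open Summit.QuantumFields.YangMills.Theorems.Prop7LaplaceAFlatLetters (norm_sq_toL2)
open Summit.QuantumFields.YangMills.Theorems.Prop7BlockDistanceWeights (sum_exp_neg_mul_tdist_coarse_le tdist_coarse_comm tdist_coarse_triangle)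

variable (F : T3Family) {n K : ℕ} {c₀ : ℝ} [Fact (0 < c₀)]

/-! ## §1 The block Cauchy–Schwarz: `ℓ¹` on a block from the `L²` block mass -/

/-- A `(K − n)`-block carries exactly `d·(L^d)^{K−n}` positively oriented bonds (by source). [cite: Balaban1985Averaging, (2) p.17] -/
theorem card_filter_src_block_eq (y : Site (F.P K) (K - n)) :
    ((Finset.univ.filter fun b : PBond (F.P K) 0 => iterBlockOf (K - n) b.src = y).card : ℝ)
      = ((F.P K).d : ℝ) * ((((F.P K).L : ℝ) ^ (F.P K).d) ^ (K - n)) := by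
  classical
  have hk : K - n ≤ (F.P K).m + (F.P K).K := by show K - n ≤ F.m + K; have := F.hm; omega
  have h1 : ((Finset.univ.filter fun b : PBond (F.P K) 0 => iterBlockOf (K - n) b.src = y).card : ℝ)
      = ∑ b : PBond (F.P K) 0, (if iterBlockOf (K - n) b.src = y then (1 : ℝ) else 0) := by
    rw [Finset.sum_boole]
  rw [h1, sum_pbond_eq]
  have h2 : ∀ x : Site (F.P K) 0, ∑ μ : Fin (F.P K).d, (if iterBlockOf (K - n) x = y then (1 : ℝ) else 0)
      = ((F.P K).d : ℝ) * (if iterBlockOf (K - n) x = y then (1 : ℝ) else 0) := fun x => by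
    rw [Finset.sum_const, Finset.card_univ, Fintype.card_fin, nsmul_eq_mul]
  rw [Finset.sum_congr rfl fun x _ => h2 x, ← Finset.mul_sum, Finset.sum_boole]
  congr 1
  have h3 : (Finset.univ.filter fun x : Site (F.P K) 0 => iterBlockOf (K - n) x = y) = iterBlock (K - n) y := by
    ext x; simp [mem_iterBlock]
  rw [h3, card_iterBlock (K - n) hk y]; push_cast; ring

/-- ★ **BLOCK CAUCHY–SCHWARZ**: `Σ_{b : B(b₋) = y} |X(b)| ≤ √(d·(L^d)^{K−n}∕c₀)·‖toL2(1_{B = y}X)‖` (`|·|` the operator norm, `≤` the Frobenius norm carried by `toL2`).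
[cite: Balaban1985BackgroundPropagators, (3.46) p.398] -/
theorem sum_norm_block_le (X : PBond (F.P K) 0 → Matrix (Fin 2) (Fin 2) ℂ) (y : Site (F.P K) (K - n)) :
    ∑ b ∈ Finset.univ.filter (fun b : PBond (F.P K) 0 => iterBlockOf (K - n) b.src = y), ‖X b‖
      ≤ Real.sqrt (((F.P K).d : ℝ) * ((((F.P K).L : ℝ) ^ (F.P K).d) ^ (K - n)) / c₀)
          * ‖toL2 F K c₀ (fun b => if iterBlockOf (K - n) b.src = y then X b else 0)‖ := by
  classical
  have hc₀ : 0 < c₀ := Fact.out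
  set S := Finset.univ.filter (fun b : PBond (F.P K) 0 => iterBlockOf (K - n) b.src = y) with hS
  -- Cauchy–Schwarz with the constant function `1`
  have hCS := Real.sum_mul_le_sqrt_mul_sqrt S (fun _ => (1 : ℝ)) (fun b => ‖X b‖)
  simp only [one_mul, one_pow, Finset.sum_const, nsmul_eq_mul, mul_one] at hCS
  -- the block `L²` mass dominates `Σ_{b ∈ y} |X b|²`
  have hmass : ∑ b ∈ S, ‖X b‖ ^ 2 ≤ ‖toL2 F K c₀ (fun b => if iterBlockOf (K - n) b.src = y then X b else 0)‖ ^ 2 / c₀ := by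
    rw [le_div_iff₀ hc₀, norm_sq_toL2, mul_comm]
    refine mul_le_mul_of_nonneg_left ?_ hc₀.le
    rw [hS, Finset.sum_filter]
    refine Finset.sum_le_sum fun b _ => ?_
    split_ifs with hb
    · rw [← norm_sq_frobEquiv_symm]
      exact pow_le_pow_left₀ (norm_nonneg _) (norm_le_norm_frobEquiv_symm _) 2
    · simp
  have hsq : Real.sqrt (∑ b ∈ S, ‖X b‖ ^ 2) ≤ ‖toL2 F K c₀ (fun b => if iterBlockOf (K - n) b.src = y then X b else 0)‖ / Real.sqrt c₀ :=
    calc Real.sqrt (∑ b ∈ S, ‖X b‖ ^ 2) ≤ Real.sqrt (‖toL2 F K c₀ (fun b => if iterBlockOf (K - n) b.src = y then X b else 0)‖ ^ 2 / c₀) :=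
          Real.sqrt_le_sqrt hmass
      _ = _ := by rw [Real.sqrt_div' _ hc₀.le, Real.sqrt_sq (norm_nonneg _)]
  calc ∑ b ∈ S, ‖X b‖ ≤ Real.sqrt (S.card : ℝ) * Real.sqrt (∑ b ∈ S, ‖X b‖ ^ 2) := hCS
    _ ≤ Real.sqrt (S.card : ℝ) * (‖toL2 F K c₀ (fun b => if iterBlockOf (K - n) b.src = y then X b else 0)‖ / Real.sqrt c₀) :=
        mul_le_mul_of_nonneg_left hsq (Real.sqrt_nonneg _)
    _ = _ := by
        rw [hS, card_filter_src_block_eq F y, Real.sqrt_div' _ hc₀.le]; ring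

/-! ## §2 Kernel row × block decay ⟹ decayed pointwise bound -/

/-- ★★★ **A DISPLAYED KERNEL ROW TIMES THE `L²` BLOCK DECAY GIVES A DECAYED POINTWISE BOUND.**  `B` linear on the one-forms with `‖(toL2⁻¹(B(toL2 δ_bZ)))(b_d)‖ ≤ C_k·e^{−μ′·tdist(B b₋, B b_d₋)}·‖Z‖`
(A2a's `hk` ∕ the EX row `h349`'s member text), `X` with the block decay `‖toL2(1_{B = y}X)‖ ≤ D₀·e^{−r·tdist(y, v)}` (A4), `0 ≤ r < μ′`.  THEN for every bond `b_d`
`‖(toL2⁻¹(B(toL2 X)))(b_d)‖ ≤ C_k·√(d·(L^d)^{K−n}∕c₀)·D₀·(2(1 + 1∕(μ′ − r)))³·e^{−r·tdist(B b_d₋, v)}` — the `s_D·e^{−r·d}` part of O4's `hqdom` for (D) and (Q).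
[cite: Balaban1985BackgroundPropagators, Thm 3.1 (3.42) p.397, (3.46) p.398, (3.49) p.399] -/
theorem norm_symm_apply_le_of_kernelRow_blockDecay (B : BondL2K ℂ 3 (periodsT3 F K) c₀ W₂ →ₗ[ℂ] BondL2K ℂ 3 (periodsT3 F K) c₀ W₂)
    {Ck μ' : ℝ} (hCk : 0 ≤ Ck)
    (hk : ∀ (b : PBond (F.P K) 0) (Z : Matrix (Fin 2) (Fin 2) ℂ) (bd : PBond (F.P K) 0),
      ‖(toL2 F K c₀).symm (B (toL2 F K c₀ (Pi.single b Z))) bd‖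
        ≤ Ck * Real.exp (-(μ' * (Site.tdist (P := F.P K) (iterBlockOf (K - n) b.src) (iterBlockOf (K - n) bd.src) : ℝ))) * ‖Z‖)
    (X : PBond (F.P K) 0 → Matrix (Fin 2) (Fin 2) ℂ) (v : Site (F.P K) (K - n)) {D₀ r : ℝ} (hD₀ : 0 ≤ D₀) (hr : 0 ≤ r) (hrμ : r < μ')
    (hD : ∀ y : Site (F.P K) (K - n),
      ‖toL2 F K c₀ (fun b => if iterBlockOf (K - n) b.src = y then X b else 0)‖ ≤ D₀ * Real.exp (-(r * (Site.tdist y v : ℝ))))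
    (bd : PBond (F.P K) 0) :
    ‖(toL2 F K c₀).symm (B (toL2 F K c₀ X)) bd‖
      ≤ Ck * Real.sqrt (((F.P K).d : ℝ) * ((((F.P K).L : ℝ) ^ (F.P K).d) ^ (K - n)) / c₀) * D₀ * (2 * (1 + 1 / (μ' - r))) ^ 3
          * Real.exp (-(r * (Site.tdist (iterBlockOf (K - n) bd.src) v : ℝ))) := by
  classical
  set Bd := iterBlockOf (K - n) bd.src with hBd
  set N : ℝ := Real.sqrt (((F.P K).d : ℝ) * ((((F.P K).L : ℝ) ^ (F.P K).d) ^ (K - n)) / c₀) with hN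
  have hN0 : 0 ≤ N := Real.sqrt_nonneg _
  -- Step 1: expand `X = Σ_b δ_b X(b)` and use the row letter
  have hexp : (toL2 F K c₀).symm (B (toL2 F K c₀ X)) bd = ∑ b : PBond (F.P K) 0, (toL2 F K c₀).symm (B (toL2 F K c₀ (Pi.single b (X b)))) bd := by
    conv_lhs => rw [← Finset.univ_sum_single X]
    rw [map_sum, map_sum, map_sum, Finset.sum_apply]
  have h1 : ‖(toL2 F K c₀).symm (B (toL2 F K c₀ X)) bd‖
      ≤ ∑ b : PBond (F.P K) 0, Ck * Real.exp (-(μ' * (Site.tdist (iterBlockOf (K - n) b.src) Bd : ℝ))) * ‖X b‖ := by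
    rw [hexp]
    exact (norm_sum_le _ _).trans (Finset.sum_le_sum fun b _ => hk b (X b) bd)
  -- Step 2: group by the block of the source and Cauchy–Schwarz inside each block
  have h2 : ∑ b : PBond (F.P K) 0, Ck * Real.exp (-(μ' * (Site.tdist (iterBlockOf (K - n) b.src) Bd : ℝ))) * ‖X b‖
      = ∑ y : Site (F.P K) (K - n), Ck * Real.exp (-(μ' * (Site.tdist y Bd : ℝ)))
          * ∑ b ∈ Finset.univ.filter (fun b : PBond (F.P K) 0 => iterBlockOf (K - n) b.src = y), ‖X b‖ := by
    rw [← Finset.sum_fiberwise_of_maps_to (s := Finset.univ) (t := Finset.univ) (g := fun b : PBond (F.P K) 0 => iterBlockOf (K - n) b.src)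
      (fun b _ => Finset.mem_univ _)]
    refine Finset.sum_congr rfl fun y _ => ?_
    rw [Finset.mul_sum]
    refine Finset.sum_congr rfl fun b hb => ?_
    rw [(Finset.mem_filter.mp hb).2]
  have h3 : ∀ y : Site (F.P K) (K - n), Ck * Real.exp (-(μ' * (Site.tdist y Bd : ℝ)))
      * ∑ b ∈ Finset.univ.filter (fun b : PBond (F.P K) 0 => iterBlockOf (K - n) b.src = y), ‖X b‖
        ≤ Ck * N * D₀ * Real.exp (-(r * (Site.tdist Bd v : ℝ))) * Real.exp (-((μ' - r) * (Site.tdist y Bd : ℝ))) := by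
    intro y
    have hb := (sum_norm_block_le F (n := n) (c₀ := c₀) X y).trans (mul_le_mul_of_nonneg_left (hD y) hN0)
    -- two-rate bracket: `e^{−μ′t(y,B_d)}·e^{−r t(y,v)} ≤ e^{−r t(B_d,v)}·e^{−(μ′−r)t(y,B_d)}`
    have htri : (Site.tdist Bd v : ℝ) ≤ (Site.tdist y Bd : ℝ) + (Site.tdist y v : ℝ) := by
      rw [tdist_coarse_comm F y Bd]; exact tdist_coarse_triangle F Bd y v
    have hexp2 : Real.exp (-(μ' * (Site.tdist y Bd : ℝ))) * Real.exp (-(r * (Site.tdist y v : ℝ)))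
        ≤ Real.exp (-(r * (Site.tdist Bd v : ℝ))) * Real.exp (-((μ' - r) * (Site.tdist y Bd : ℝ))) := by
      rw [← Real.exp_add, ← Real.exp_add, Real.exp_le_exp]
      nlinarith [mul_le_mul_of_nonneg_left htri hr]
    calc Ck * Real.exp (-(μ' * (Site.tdist y Bd : ℝ)))
          * ∑ b ∈ Finset.univ.filter (fun b : PBond (F.P K) 0 => iterBlockOf (K - n) b.src = y), ‖X b‖
        ≤ Ck * Real.exp (-(μ' * (Site.tdist y Bd : ℝ))) * (N * (D₀ * Real.exp (-(r * (Site.tdist y v : ℝ))))) :=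
          mul_le_mul_of_nonneg_left hb (by positivity)
      _ = Ck * N * D₀ * (Real.exp (-(μ' * (Site.tdist y Bd : ℝ))) * Real.exp (-(r * (Site.tdist y v : ℝ)))) := by ring
      _ ≤ Ck * N * D₀ * (Real.exp (-(r * (Site.tdist Bd v : ℝ))) * Real.exp (-((μ' - r) * (Site.tdist y Bd : ℝ)))) :=
          mul_le_mul_of_nonneg_left hexp2 (by positivity)
      _ = _ := by ring
  -- Step 3: the K-free coarse volume
  have hνpos : 0 < μ' - r := by linarith
  have hvol := sum_exp_neg_mul_tdist_coarse_le F (n := n) (K := K) hνpos Bd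
  calc ‖(toL2 F K c₀).symm (B (toL2 F K c₀ X)) bd‖
      ≤ ∑ y : Site (F.P K) (K - n), Ck * Real.exp (-(μ' * (Site.tdist y Bd : ℝ)))
          * ∑ b ∈ Finset.univ.filter (fun b : PBond (F.P K) 0 => iterBlockOf (K - n) b.src = y), ‖X b‖ := h1.trans_eq h2
    _ ≤ ∑ y : Site (F.P K) (K - n), Ck * N * D₀ * Real.exp (-(r * (Site.tdist Bd v : ℝ))) * Real.exp (-((μ' - r) * (Site.tdist y Bd : ℝ))) :=
        Finset.sum_le_sum fun y _ => h3 y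
    _ = Ck * N * D₀ * Real.exp (-(r * (Site.tdist Bd v : ℝ))) * ∑ y : Site (F.P K) (K - n), Real.exp (-((μ' - r) * (Site.tdist y Bd : ℝ))) := by
        rw [Finset.mul_sum]
    _ ≤ Ck * N * D₀ * Real.exp (-(r * (Site.tdist Bd v : ℝ))) * (2 * (1 + 1 / (μ' - r))) ^ 3 :=
        mul_le_mul_of_nonneg_left hvol (by positivity)
    _ = _ := by ring

end Summit.QuantumFields.YangMills.Theorems.Prop7OneFormRemainderDecay

end
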